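import Mathlib
import Literature.Analysis.FluidPDE.CompressibleEulerImplosionCoreEnvelopeWindow2
import Summits.AtomisticToContinuum.HydrodynamicLimit.Theorems.ImplosionDichotomyDenseExcursionSonicPinnedBulkEnvelopes

/-!
# The pinned BCG profile: the certified core envelope (b), (c) of `CavityTube` on `x ≤ −1/3`
# (crux `DenseExcursion`, line `sonic-cavity-renewal`, brick `core_envelope_certified` of stub `stub_boxPackage`)

Helper file (`--supports stmt-AtomisticToContinuum-12586`) for the registered stub `stub_boxPackage` of the line
`sonic-cavity-renewal` (crux `Summit.AtomisticToContinuum.HydrodynamicLimit.Theses.ImplosionDichotomy.DenseExcursion`):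
clauses (b) (radial repulsivity `1 − W − W′ − |S + S′| ≥ 3/8`, angular `1 − W − |S + S′| ≥ 5/8`) and (c) (the `C²`
envelope `|W| ≤ 1/4`, `|W′| ≤ 1/2`, `|W″| ≤ 6`, `7/10 ≤ eˣS ≤ 1`, `|(eˣS)′| ≤ 1/4`, `|(eˣS)″| ≤ 2`) of `CavityTube`
(`…SonicCavityDefs`) ON THE REACH `x ≤ −1/3` OF THE CENTRE SERIES, for the pinned profile of `bulk_envelopes_certified`
(`…SonicPinnedBulkEnvelopes`). There `c eˣ < 17/50`, the profile is the series profile `(Wser r c, Sser r c)`, and for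
the series profile the clauses are the Literature theorem `OriginSeries.CentreW2.core_envelope_window2`
(`Literature/…/CompressibleEulerImplosionCoreEnvelopeWindow2.lean`: on `[−2, −1/3]` the kernel certificate
`core_pos_window2` — edge Taylor models with all sixty certified heads and the `Θ`-tail, sixteen sign conditions by
`posOn`, `decide +kernel` —, on `x ≤ −2` the certified centre expansion (d)).

* `core_envelope_series` — (b) and (c) at every `x ≤ −1/3` for `(Wser r c, Sser r c)`, every `r` in the shooting window and
  every `c ∈ [17/50, 23/50]`;
* `core_envelope_certified` (registered) — all clauses of `bulk_envelopes_certified` AND (b), (c) on `x ≤ −1/3` for the witness.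

What is left of (b), (c) for the witness: the near-sonic and exterior range `−1/3 < x ≤ 1` (outside the disc of the centre series).

Sources: Buckmaster–Cao-Labora–Gómez-Serrano 2025, Thm 1.1, Prop. 2.5, App. B.
-/

noncomputable section

open Set Filter Topology

namespace Summit.AtomisticToContinuum.HydrodynamicLimit.Theorems.SonicCavityRenewal

open Literature.Analysis.FluidPDE.BuckmasterCaolaboraGomezserrano2025
open Literature.Analysis.FluidPDE.BuckmasterCaolaboraGomezserrano2025.OriginSeries.CentreW2
open Summit.AtomisticToContinuum.HydrodynamicLimit.Theorems.R2OneModeTwoConditions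

/-- **Clauses (b), (c) of the cavity tube for the series profile on `x ≤ −1/3`**, for every speed `r` in the shooting
window `[13890041/12500000, 697/625]` and every sonic scale `c ∈ [17/50, 23/50]`.
[cite: BuckmasterCaolaboraGomezserrano2025, Prop. 2.5, App. B] -/
theorem core_envelope_series : ∀ (r c : ℝ), (13890041 / 12500000 : ℝ) ≤ r → r ≤ 697 / 625 → 17 / 50 ≤ c → c ≤ 23 / 50 →
    ∀ x : ℝ, x ≤ -(1 / 3) →
    3 / 8 ≤ 1 - OriginSeries.CentreW2.Wser r c x - deriv (OriginSeries.CentreW2.Wser r c) x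
      - |OriginSeries.CentreW2.Sser r c x + deriv (OriginSeries.CentreW2.Sser r c) x| ∧
    5 / 8 ≤ 1 - OriginSeries.CentreW2.Wser r c x - |OriginSeries.CentreW2.Sser r c x + deriv (OriginSeries.CentreW2.Sser r c) x| ∧
    (|OriginSeries.CentreW2.Wser r c x| ≤ 1 / 4 ∧ |deriv (OriginSeries.CentreW2.Wser r c) x| ≤ 1 / 2 ∧
      |deriv (deriv (OriginSeries.CentreW2.Wser r c)) x| ≤ 6) ∧
    (7 / 10 ≤ Real.exp x * OriginSeries.CentreW2.Sser r c x ∧ Real.exp x * OriginSeries.CentreW2.Sser r c x ≤ 1 ∧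
      |deriv (fun y => Real.exp y * OriginSeries.CentreW2.Sser r c y) x| ≤ 1 / 4 ∧
      |deriv (deriv (fun y => Real.exp y * OriginSeries.CentreW2.Sser r c y)) x| ≤ 2) := by
  intro r c h1 h2 h3 h4
  have hr : r ∈ Set.Icc ((13890041/12500000 : ℚ) : ℝ) ((697/625 : ℚ) : ℝ) := by
    refine ⟨?_, ?_⟩ <;> push_cast <;> linarith
  exact core_envelope_window2 hr ⟨h3, h4⟩

/-- **Brick `core_envelope_certified` of stub `stub_boxPackage` (line `sonic-cavity-renewal`): THE PINNED PROFILE WITH ITS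
CERTIFIED BULK ENVELOPES AND CORE ENVELOPE.** There are a speed `r` in the shooting window, a sonic scale `c ∈ [17/50, 23/50]`
and a profile `(W, S)` with all the clauses of `bulk_envelopes_certified` (in particular `CavityTubeBulk r W S`) AND clauses
(b), (c) of `CavityTube` at every `x ≤ −1/3`. [cite: BuckmasterCaolaboraGomezserrano2025, Thm 1.1, Prop. 2.5, App. B] -/
theorem core_envelope_certified : ∃ (r c : ℝ) (W S : ℝ → ℝ), ((13890041 / 12500000 : ℝ) ≤ r ∧ r ≤ 697 / 625) ∧ IsMonatomicProfile r W S ∧ OrigProfileEqs r W S ∧ W 0 + S 0 = 1 ∧ (∀ x, x < 0 → 1 < W x + S x) ∧ (∀ x, 0 < x → W x + S x < 1) ∧ deriv W 0 + deriv S 0 = -(2 - r - Real.sqrt (2 * (r - 1))) ∧ deriv W 0 + deriv S 0 ≤ -(2 / 5) ∧ W 0 = (r - Real.sqrt (r ^ 2 - 6 * r + 6)) / 2 ∧ AnalyticAt ℝ W 0 ∧ AnalyticAt ℝ S 0 ∧ (17 / 50 ≤ c ∧ c ≤ 23 / 50) ∧ (∀ x, c * Real.exp x < 17 / 50 → W x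 = OriginSeries.CentreW2.Wser r c x ∧ S x = OriginSeries.CentreW2.Sser r c x) ∧ CavityTubeBulk r W S ∧ (∀ x, x ≤ -(1 / 3) → 3 / 8 ≤ 1 - W x - deriv W x - |S x + deriv S x| ∧ 5 / 8 ≤ 1 - W x - |S x + deriv S x| ∧ (|W x| ≤ 1 / 4 ∧ |deriv W x| ≤ 1 / 2 ∧ |deriv (deriv W) x| ≤ 6) ∧ (7 / 10 ≤ Real.exp x * S x ∧ Real.exp x * S x ≤ 1 ∧ |deriv (fun y => Real.exp y * S y) x| ≤ 1 / 4 ∧ |deriv (deriv (fun y => Real.exp y * S y)) x| ≤ 2)) ∧ ∃ W₂ s₀ s₂ : ℝ, |W₂| ≤ 1 / 10 ∧ 7 / 10 ≤ s₀ ∧ s₀ ≤ 1 ∧ |s₂| ≤ 1 / 10 ∧ ∀ x, x ≤ -(1 / 3) → |W x - (r - 1) - W₂ * Real.exp (2 * x)| ≤ 2 * Real.exp (4 * x) ∧ |deriv W x - 2 * W₂ * Real.exp (2 * x)| ≤ 2 * Real.exp (4 * x) ∧ |deriv (deriv W) x - 4 * W₂ * Real.exp (2 * x)| ≤ 2 *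 Real.exp (4 * x) ∧ |Real.exp x * S x - s₀ - s₂ * Real.exp (2 * x)| ≤ 2 * Real.exp (4 * x) ∧ |deriv (fun y => Real.exp y * S y) x - 2 * s₂ * Real.exp (2 * x)| ≤ 2 * Real.exp (4 * x) ∧ |deriv (deriv (fun y => Real.exp y * S y)) x - 4 * s₂ * Real.exp (2 * x)| ≤ 2 * Real.exp (4 * x) := by
  obtain ⟨r, c, W, S, hr, hmono, heqs, h0, hneg, hpos, hκ', hκ, hW0, haW, haS, ⟨hclb, hcub⟩, hident, hbulk, W₂, s₀, s₂, hW2,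
    hs0a, hs0b, hs2, hd⟩ := bulk_envelopes_certified
  refine ⟨r, c, W, S, hr, hmono, heqs, h0, hneg, hpos, hκ', hκ, hW0, haW, haS, ⟨hclb, hcub⟩, hident, hbulk, ?_, W₂, s₀, s₂,
    hW2, hs0a, hs0b, hs2, hd⟩
  have hseries := core_envelope_series r c hr.1 hr.2 hclb hcub
  have hUopen : IsOpen {y : ℝ | c * Real.exp y < 17 / 50} :=
    isOpen_lt (continuous_const.mul Real.continuous_exp) continuous_const
  have hthird : ∀ x : ℝ, x ≤ -(1 / 3) → c * Real.exp x < 17 / 50 := by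
    intro x hx
    have h1 : Real.exp x ≤ 7169 / 10000 := (Real.exp_le_exp.mpr hx).trans exp_neg_third_le
    nlinarith [Real.exp_pos x]
  have hWev : ∀ x : ℝ, c * Real.exp x < 17 / 50 → W =ᶠ[𝓝 x] Wser r c := fun x hx => by
    filter_upwards [hUopen.mem_nhds hx] with y hy using (hident y hy).1
  have hSev : ∀ x : ℝ, c * Real.exp x < 17 / 50 → S =ᶠ[𝓝 x] Sser r c := fun x hx => by
    filter_upwards [hUopen.mem_nhds hx] with y hy using (hident y hy).2
  have hTev : ∀ x : ℝ, c * Real.exp x < 17 / 50 → (fun y => Real.exp y * S y) =ᶠ[𝓝 x] (fun y => Real.exp y * Sser r c y) :=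
    fun x hx => by
    filter_upwards [hUopen.mem_nhds hx] with y hy
    rw [(hident y hy).2]
  have hdWev : ∀ x : ℝ, c * Real.exp x < 17 / 50 → deriv W =ᶠ[𝓝 x] deriv (Wser r c) := fun x hx => by
    filter_upwards [hUopen.mem_nhds hx] with y hy using (hWev y hy).deriv_eq
  have hdTev : ∀ x : ℝ, c * Real.exp x < 17 / 50 →
      deriv (fun y => Real.exp y * S y) =ᶠ[𝓝 x] deriv (fun y => Real.exp y * Sser r c y) := fun x hx => by
    filter_upwards [hUopen.mem_nhds hx] with y hy using (hTev y hy).deriv_eq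
  intro x hx
  have hxU := hthird x hx
  rw [(hdWev x hxU).deriv_eq, (hWev x hxU).deriv_eq, (hWev x hxU).eq_of_nhds, (hdTev x hxU).deriv_eq, (hTev x hxU).deriv_eq,
    (hSev x hxU).deriv_eq, (hSev x hxU).eq_of_nhds]
  exact hseries x hx

end Summit.AtomisticToContinuum.HydrodynamicLimit.Theorems.SonicCavityRenewal

end
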